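import Mathlib
import HarnessLib
import Summits.HubbardSuperconductivity.HubbardSuperconductivity.Theorems.ComplexGFFStiffnessHolomorphicTorusFamily
import Summits.HubbardSuperconductivity.HubbardSuperconductivity.Theorems.ComplexGFFStiffnessHypACumulantHolomorphicAssembly
import Literature.MathematicalPhysics.StatisticalMechanics.AbkmPackageShrink
import Literature.MathematicalPhysics.StatisticalMechanics.FlowWeightIntegrability

/-!
# Crux `HypACumulant`, children `H1bcStatement` / `F4StatementOfCores` — the holomorphic route ASSEMBLED for an
# [ABKM19] package: Lipschitz and parallelogram bounds of `S_k^{(q)}` along complex state lines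

Route `route-HubbardSuperconductivity-ComplexGFFStiffness`, crux stmt-HubbardSuperconductivity-19154, children
stmt-…-27380 (`H1bcStatement`, slot `H1σ2`) and stmt-…-27379 (slot `F4l'`).  For a package `P : PackageData d`
realised at height `N` (`Q : PackageAt P N M`) and a tuning parameter `q` in the ball, the step data
`abkmStepData P.L P.R k (Q.kernels q)` carry `StepKernelBounds` (`packageAt_stepKernelBounds`), and `Q.opS q k u v`
is `restrictConn ∘ nextKStep ∘ (toHam, mulExt)` on the Theorem-6.8 ball (`packageAt_coe_opS`).  Feeding the
model-specific discharge `differentiableOn_nextKStep_abkm_lineAct` (pointwise holomorphy), Theorem 6.8 on the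
`P.r`-ball (`weakNormLE_nextKStep_abkm_ball_of_stepKernelBounds`, the UNIFORM bound `σ(r)·r`), per-parameter
smoothness (`contDiff_nextKStep_abkm_of_stepKernelBounds`) and continuity of the weights into the engines of
`…HolomorphicAssembly` gives, for complex lines / bidiscs of radius `R` whose states stay in the `P.r`-ball:

* **`weakNormLE_secondDiff_nextKStep_package`** — parallelogram second differences of
  `(σ, τ) ↦ S_k^{(q)}(H₀ + σU₁ + τU₂, mulExt(a + σb₁ + τb₂))`: `≤ (r₀+1)·(4σ(r)r/R²)·|σ||τ|`;
* **`weakNormLE_sub_nextKStep_pair_package`** — first differences of the TWO-KERNEL difference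
  `σ ↦ (S_k^{(q')} − S_k^{(q)})(H₀ + σU, mulExt(a + σb))` from a uniform bound `C_q` of that difference on the disc:
  `≤ (r₀+1)·(2C_q/R)·|σ|`.

These are the two inputs of the shrunk-radius slots `H1σ2 P.shrink` and `F4l' P.shrink` (sequel files).  All proved,
no `sorry`.  Honest scope: rung route (stiffness of a complex Gaussian gradient field via the [ABKM19] RG); nothing
about superconductivity in the Hubbard model.

## References
* S. Adams, S. Buchholz, R. Kotecký, S. Müller, arXiv:1910.13564, Theorem 6.8, Ch. 12 (12.4), Lemma 12.6
  [AdamsBuchholzKoteckyMuller2019].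
-/

noncomputable section

-- `Summit.<Summit>.<Problem>`: single-conjunct summit, the duplicate component is mandated (D-0017).
set_option linter.dupNamespace false

namespace Summit.HubbardSuperconductivity.HubbardSuperconductivity.Theorems.ComplexGFF

open MeasureTheory Metric Set
open scoped BigOperators
open Literature.MathematicalPhysics.StatisticalMechanics.GradientRG
open Literature.MathematicalPhysics.StatisticalMechanics.TorusPolymer (IsPolymer blockOf)
open Literature.Barriers.CriticalPhenomena.LongRangePhi4.Polymer (IsConn)
open Literature.MathematicalPhysics.StatisticalMechanics

variable {d : ℕ}

/-! ## Package plumbing -/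

section Package

variable (P : PackageData d) [Fact (0 < P.h)] [Fact (0 < P.L)] {N M : ℕ} [NeZero M] (Q : PackageAt P N M)

omit [Fact (0 < P.h)] [Fact (0 < P.L)] in
/-- **The step kernels `𝒞_{1+q,k+1}` of a package on the ball carry `StepKernelBounds`** with the `N`-free
integration constant `A_𝒫'` of the package. -/
theorem packageAt_stepKernelBounds {q : Matrix (Fin d) (Fin d) ℝ} (hq : P.InBall q) {k : ℕ} (hk : k + 1 ≤ N) :
    StepKernelBounds (abkmWeightData P.L N P.Mord P.R P.θbar (schedDelta P.δ₀ P.δ₁ N) fun j => Q.𝒞 1 j) P.L k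
      P.A𝒫' (secondDiffConst fun θ' => P.Cα θ' 0) (Q.kernels q (k + 1)) := by
  have h := stepKernelBounds_family_of_torusFRD P.hd P.hMord P.hMR P.hLodd P.hL P.hθbar P.hlam P.hn P.hn2 P.hnñ
    P.hc P.hC1 Q.hallA Q.hB P.hθ0 P.hθ P.hT₀ P.hKT₀ hq.1 hq.2 k hk
  rw [P.hA𝒫'] at h
  exact h

/-- `hamNorm (toHam u) = ‖u‖` (plumbing). -/
theorem hamNorm_toHam_eq {k : ℕ}
    (u : HamSpace ℂ d (fieldWt P.h (P.L : ℝ) d k) ((P.L : ℝ) ^ k) (P.L ^ (d * k))) :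
    hamNorm (fieldWt P.h (P.L : ℝ) d k) ((P.L : ℝ) ^ k) (P.L ^ (d * k)) (HamSpace.toHam u) = ‖u‖ :=
  (HamSpace.norm_def u).symm

/-- **On the Theorem-6.8 ball, `S_k^{(q)}(u, v)` IS `restrictConn (nextKStep (abkmStepData) (toHam u) (mulExt v))`**
(the membership branch of `rgSQ`). -/
theorem packageAt_coe_opS {q : Matrix (Fin d) (Fin d) ℝ} (hq : P.InBall q) {k : ℕ} (hk : k + 1 ≤ N)
    (u : HamSpace ℂ d (fieldWt P.h (P.L : ℝ) d k) ((P.L : ℝ) ^ k) (P.L ^ (d * k)))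
    (v : activitySpace Q.normParams k) {cv : ℝ} (hu : ‖u‖ ≤ P.r) (hv : activityNormLE Q.normParams k v cv)
    (hcv : cv ≤ P.r) :
    ((Q.opS q k u v : activitySpace Q.normParams (k + 1)) :
        Finset (Fin d → ZMod M) → ((Fin d → ZMod M) → ℝ) → ℂ) =
      restrictConn (P.L ^ (k + 1)) (nextKStep (abkmStepData P.L P.R k (Q.kernels q)) (HamSpace.toHam u)
        (mulExt (v : Finset (Fin d → ZMod M) → ((Fin d → ZMod M) → ℝ) → ℂ))) := by
  have hPA : 0 < Q.normParams.A := P.A_pos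
  have hk1 : 1 ≤ P.L ^ k := Nat.one_le_pow _ _ P.hLodd.pos
  have hH : hamNorm (fieldWt P.h (P.L : ℝ) d k) ((P.L : ℝ) ^ k) (P.L ^ (d * k)) (HamSpace.toHam u) ≤ P.r := by
    rw [hamNorm_toHam_eq]; exact hu
  have hK : WeakNormLE Q.normParams k
      (mulExt (v : Finset (Fin d → ZMod M) → ((Fin d → ZMod M) → ℝ) → ℂ)) P.r :=
    (activitySpace.weakNormLE_mulExt v hv).mono hPA hcv
  have hmem := restrictConn_nextKStep_mem_activitySpace_of_stepKernelBounds P.hd P.hLodd P.hL P.hR2 Q.hM hk P.hp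
    P.hpM P.hMR P.hr₀ Q.hB P.hδ₀ P.hδ₁ P.hh P.hh0 P.hh2 P.A𝒫'_nonneg P.hA1 P.hA𝒫A P.hsmall
    (abkmStepData P.L P.R k (Q.kernels q)) rfl rfl (packageAt_stepKernelBounds P Q hq hk) (x₀ := 0) rfl rfl hH P.hr
    hK (factorises_mulExt hk1) (fun φ => mulExt_empty φ) (activitySpace.contDiff_mulExt v)
    (fun Y hY hYc => activitySpace.isGaugeLocal_mulExt v hY hYc) (activitySpace.transInv_mulExt v)
    P.hv P.hωA P.hc3A P.hc2A
  unfold PackageAt.opS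
  exact coe_rgSQ_of_mem hmem

end Package

/-! ## Complex scalars on Hamiltonians -/

/-- `‖c • H‖_{k,0} = ‖c‖ ‖H‖_{k,0}` for a complex scalar. -/
theorem hamNorm_complex_smul (𝔥 Rg : ℝ) (n : ℕ) (c : ℂ) (H : RelevantHamiltonian ℂ d) :
    hamNorm 𝔥 Rg n (c • H) = ‖c‖ * hamNorm 𝔥 Rg n H := by
  unfold hamNorm
  simp only [Pi.smul_apply, norm_smul]
  have e1 : ∑ α : linIndex d, 𝔥 * (Rg ^ (∑ i, (α : Fin d → ℕ) i))⁻¹ * (‖c‖ * ‖H (Sum.inr (Sum.inl α))‖) =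
      ‖c‖ * ∑ α : linIndex d, 𝔥 * (Rg ^ (∑ i, (α : Fin d → ℕ) i))⁻¹ * ‖H (Sum.inr (Sum.inl α))‖ := by
    rw [Finset.mul_sum]
    exact Finset.sum_congr rfl fun α _ => by ring
  have e2 : ∑ q : quadIndex d, (𝔥 / Rg) ^ 2 * (‖c‖ * ‖H (Sum.inr (Sum.inr q))‖) =
      ‖c‖ * ∑ q : quadIndex d, (𝔥 / Rg) ^ 2 * ‖H (Sum.inr (Sum.inr q))‖ := by
    rw [Finset.mul_sum]
    exact Finset.sum_congr rfl fun q _ => by ring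
  rw [e1, e2]
  ring

/-- `‖H₀ + σU₁ + τU₂‖_{k,0} ≤ ‖H₀‖ + ‖σ‖‖U₁‖ + ‖τ‖‖U₂‖` (`𝔥, R ≥ 0`). -/
theorem hamNorm_line₂_le {𝔥 Rg : ℝ} (h𝔥 : 0 ≤ 𝔥) (hR : 0 ≤ Rg) (n : ℕ) (H₀ U₁ U₂ : RelevantHamiltonian ℂ d)
    (σ τ : ℂ) :
    hamNorm 𝔥 Rg n (H₀ + σ • U₁ + τ • U₂) ≤
      hamNorm 𝔥 Rg n H₀ + ‖σ‖ * hamNorm 𝔥 Rg n U₁ + ‖τ‖ * hamNorm 𝔥 Rg n U₂ := by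
  have h1 := hamNorm_add_le h𝔥 hR n (H₀ + σ • U₁) (τ • U₂)
  have h2 := hamNorm_add_le h𝔥 hR n H₀ (σ • U₁)
  rw [hamNorm_complex_smul] at h1 h2
  linarith

/-! ## The two engines for a package -/

section Engines

variable (P : PackageData d) {N M : ℕ} [NeZero M] (Q : PackageAt P N M)

set_option maxHeartbeats 800000 in
/-- **Parallelogram second differences of `S_k^{(q)}` along complex state lines** (the `(H,K)`-slot of the
holomorphic route for a package): for states `(H₀ + σU₁ + τU₂, mulExt(a + σb₁ + τb₂))` that stay in the
Theorem-6.8 ball of `P` for `|σ|, |τ| < R` (`‖H₀‖ + R‖U₁‖ + R‖U₂‖ ≤ P.r`, `C_a + R C_{b₁} + R C_{b₂} ≤ P.r`), the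
mixed second difference at `(σ, τ)` has weak norm `≤ (r₀+1)·(4σ(r)r/R²)·|σ|·|τ|`. -/
theorem weakNormLE_secondDiff_nextKStep_package {q : Matrix (Fin d) (Fin d) ℝ} (hq : P.InBall q) {k : ℕ}
    (hk : k + 1 ≤ N) (H₀ U₁ U₂ : RelevantHamiltonian ℂ d)
    {a b₁ b₂ : Finset (Fin d → ZMod M) → ((Fin d → ZMod M) → ℝ) → ℂ} {Ca Cb₁ Cb₂ : ℝ}
    (hCa : 0 ≤ Ca) (hCb₁ : 0 ≤ Cb₁) (hCb₂ : 0 ≤ Cb₂)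
    (ha : WeakNormLE Q.normParams k a Ca) (hb₁ : WeakNormLE Q.normParams k b₁ Cb₁)
    (hb₂ : WeakNormLE Q.normParams k b₂ Cb₂)
    (had : ∀ Y, ContDiff ℝ P.r₀ (a Y)) (hb₁d : ∀ Y, ContDiff ℝ P.r₀ (b₁ Y)) (hb₂d : ∀ Y, ContDiff ℝ P.r₀ (b₂ Y))
    (haloc : ∀ Y, IsPolymer (P.L ^ k) Y → IsConn Y → IsGaugeLocal (Q.normParams.gauge k Y) (a Y))
    (hb₁loc : ∀ Y, IsPolymer (P.L ^ k) Y → IsConn Y → IsGaugeLocal (Q.normParams.gauge k Y) (b₁ Y))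
    (hb₂loc : ∀ Y, IsPolymer (P.L ^ k) Y → IsConn Y → IsGaugeLocal (Q.normParams.gauge k Y) (b₂ Y))
    (hat : TransInv (P.L ^ k) a) (hb₁t : TransInv (P.L ^ k) b₁) (hb₂t : TransInv (P.L ^ k) b₂)
    {R : ℝ}
    (hHball : hamNorm (fieldWt P.h (P.L : ℝ) d k) ((P.L : ℝ) ^ k) (P.L ^ (d * k)) H₀ +
      R * hamNorm (fieldWt P.h (P.L : ℝ) d k) ((P.L : ℝ) ^ k) (P.L ^ (d * k)) U₁ +
      R * hamNorm (fieldWt P.h (P.L : ℝ) d k) ((P.L : ℝ) ^ k) (P.L ^ (d * k)) U₂ ≤ P.r)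
    (hKball : Ca + R * Cb₁ + R * Cb₂ ≤ P.r) {σ τ : ℂ} (hσ : σ ∈ ball (0 : ℂ) R) (hτ : τ ∈ ball (0 : ℂ) R) :
    WeakNormLE Q.normParams (k + 1)
      (fun X ψ =>
        nextKStep (abkmStepData P.L P.R k (Q.kernels q)) (H₀ + σ • U₁ + τ • U₂) (mulExt (a + σ • b₁ + τ • b₂)) X ψ -
        nextKStep (abkmStepData P.L P.R k (Q.kernels q)) (H₀ + σ • U₁ + (0 : ℂ) • U₂)
          (mulExt (a + σ • b₁ + (0 : ℂ) • b₂)) X ψ -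
        nextKStep (abkmStepData P.L P.R k (Q.kernels q)) (H₀ + (0 : ℂ) • U₁ + τ • U₂)
          (mulExt (a + (0 : ℂ) • b₁ + τ • b₂)) X ψ +
        nextKStep (abkmStepData P.L P.R k (Q.kernels q)) (H₀ + (0 : ℂ) • U₁ + (0 : ℂ) • U₂)
          (mulExt (a + (0 : ℂ) • b₁ + (0 : ℂ) • b₂)) X ψ)
      (((P.r₀ : ℝ) + 1) * (4 * (sigmaABKM d P.L P.R P.A P.A𝒫' P.r * P.r) / R ^ 2) * ‖σ‖ * ‖τ‖) := by
  set D := abkmStepData P.L P.R k (Q.kernels q) with hD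
  set F : ℂ → ℂ → Finset (Fin d → ZMod M) → ((Fin d → ZMod M) → ℝ) → ℂ :=
    fun σ τ => nextKStep D (H₀ + σ • U₁ + τ • U₂) (mulExt (a + σ • b₁ + τ • b₂)) with hF
  have hS := packageAt_stepKernelBounds P Q hq hk
  have hPA : 0 < Q.normParams.A := P.A_pos
  have hL0 : (0 : ℝ) < P.L := by exact_mod_cast P.hLodd.pos
  have h𝔥 : 0 ≤ fieldWt P.h (P.L : ℝ) d k := (fieldWt_pos P.hh hL0 d k).le
  have hRk : (0 : ℝ) ≤ (P.L : ℝ) ^ k := by positivity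
  have hk1 : 1 ≤ P.L ^ k := Nat.one_le_pow _ _ P.hLodd.pos
  have hr2 : (2 : ℕ) ≤ P.r₀ := le_trans (by norm_num) P.hr₀
  have hn0 : ∀ G : RelevantHamiltonian ℂ d, 0 ≤ hamNorm (fieldWt P.h (P.L : ℝ) d k) ((P.L : ℝ) ^ k) (P.L ^ (d * k)) G :=
    fun G => hamNorm_nonneg h𝔥 hRk _ _
  -- on the bidisc the states stay in the ball
  have hHστ : ∀ σ' ∈ ball (0 : ℂ) R, ∀ τ' ∈ ball (0 : ℂ) R,
      hamNorm (fieldWt P.h (P.L : ℝ) d k) ((P.L : ℝ) ^ k) (P.L ^ (d * k)) (H₀ + σ' • U₁ + τ' • U₂) ≤ P.r := by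
    intro σ' hσ' τ' hτ'
    have h1 := hamNorm_line₂_le h𝔥 hRk (P.L ^ (d * k)) H₀ U₁ U₂ σ' τ'
    have hσ'' : ‖σ'‖ ≤ R := le_of_lt (mem_ball_zero_iff.1 hσ')
    have hτ'' : ‖τ'‖ ≤ R := le_of_lt (mem_ball_zero_iff.1 hτ')
    nlinarith [hn0 U₁, hn0 U₂]
  have hKστ : ∀ σ' ∈ ball (0 : ℂ) R, ∀ τ' ∈ ball (0 : ℂ) R,
      WeakNormLE Q.normParams k (mulExt (a + σ' • b₁ + τ' • b₂)) P.r := by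
    intro σ' hσ' τ' hτ'
    have hσ'' : ‖σ'‖ ≤ R := le_of_lt (mem_ball_zero_iff.1 hσ')
    have hτ'' : ‖τ'‖ ≤ R := le_of_lt (mem_ball_zero_iff.1 hτ')
    have h := weakNormLE_lineAct (weakNormLE_lineAct ha hb₁ had hb₁d σ') hb₂ (contDiff_lineAct had hb₁d σ') hb₂d τ'
    refine weakNormLE_mulExt_iff.2 (h.mono hPA ?_)
    nlinarith
  -- admissibility of the bidisc activities
  have hKd : ∀ σ' τ' Y, ContDiff ℝ P.r₀ (mulExt (a + σ' • b₁ + τ' • b₂) Y) := fun σ' τ' Y =>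
    contDiff_mulExt (contDiff_lineAct (contDiff_lineAct had hb₁d σ') hb₂d τ') Y
  have hKloc : ∀ σ' τ' Y, IsPolymer (P.L ^ k) Y → IsConn Y →
      IsGaugeLocal (Q.normParams.gauge k Y) (mulExt (a + σ' • b₁ + τ' • b₂) Y) := fun σ' τ' Y hY hYc =>
    isGaugeLocal_mulExt_conn (Q.normParams.gauge k)
      (fun Y' hY' hY'c => isGaugeLocal_lineAct (isGaugeLocal_lineAct (haloc Y' hY' hY'c) (hb₁loc Y' hY' hY'c) σ')
        (hb₂loc Y' hY' hY'c) τ') hY hYc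
  have hKt : ∀ σ' τ', TransInv (P.L ^ k) (mulExt (a + σ' • b₁ + τ' • b₂)) := fun σ' τ' =>
    transInv_mulExt (transInv_lineAct (transInv_lineAct hat hb₁t σ') hb₂t τ')
  -- the three inputs of the engine
  have hw : ∀ X, Continuous (Q.normParams.W.weight (k + 1) X) := fun X => continuous_weight _ (k + 1) X
  have hC : ∀ σ' ∈ ball (0 : ℂ) R, ∀ τ' ∈ ball (0 : ℂ) R,
      WeakNormLE Q.normParams (k + 1) (F σ' τ') (sigmaABKM d P.L P.R P.A P.A𝒫' P.r * P.r) := by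
    intro σ' hσ' τ' hτ'
    exact weakNormLE_nextKStep_abkm_ball_of_stepKernelBounds P.hd P.hLodd P.hL P.hR2 Q.hM hk P.hp P.hpM P.hMR P.hr₀
      Q.hB P.hδ₀ P.hδ₁ P.hh P.hh0 P.hh2 P.A𝒫'_nonneg P.hA1 P.hA𝒫A P.hsmall D rfl rfl hS (x₀ := 0) rfl rfl
      (hHστ σ' hσ' τ' hτ') P.hr (hKστ σ' hσ' τ' hτ') (factorises_mulExt hk1) (fun φ => mulExt_empty φ) (hKd σ' τ')
      (hKloc σ' τ') (hKt σ' τ') P.hv P.hωA P.hc3A P.hc2A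
  have hKc : ∀ σ' ∈ ball (0 : ℂ) R, ∀ τ' ∈ ball (0 : ℂ) R, ∀ X,
      ContDiff ℝ (Q.normParams.r₀ : WithTop ℕ∞) (F σ' τ' X) := by
    intro σ' hσ' τ' hτ' X
    have h8 : hamNorm (fieldWt P.h (P.L : ℝ) d k) ((P.L : ℝ) ^ k) (P.L ^ (d * k)) (H₀ + σ' • U₁ + τ' • U₂) ≤ 1 / 8 :=
      (hHστ σ' hσ' τ' hτ').trans (P.hr.trans (by norm_num))
    exact contDiff_nextKStep_abkm_of_stepKernelBounds P.hd P.hLodd P.hL Q.hM hk P.hp P.hpM P.hMR Q.hB P.hδ₀ P.hδ₁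
      P.hh P.hh0 P.hA1 D rfl rfl hS (x₀ := 0) rfl rfl h8 P.hr0 (hKστ σ' hσ' τ' hτ') (factorises_mulExt hk1)
      (fun φ => mulExt_empty φ) (hKd σ' τ') (hKloc σ' τ') X
  -- separate holomorphy
  have hholτ : ∀ σ' ∈ ball (0 : ℂ) R, ∀ X ψ, DifferentiableOn ℂ (fun τ' => F σ' τ' X ψ) (ball (0 : ℂ) R) := by
    intro σ' hσ' X ψ
    have h := differentiableOn_nextKStep_abkm_lineAct P.hd P.hLodd P.hL Q.hM hk P.hp P.hpM P.hMR hr2 Q.hB P.hδ₀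
      P.hδ₁ P.hh P.hh0 P.hA1 (Q.kernels q) hS (H₀ + σ' • U₁) U₂ (a := a + σ' • b₁) (b := b₂)
      (Ca := Ca + ‖σ'‖ * Cb₁) (Cb := Cb₂) (by positivity) hCb₂ (weakNormLE_lineAct ha hb₁ had hb₁d σ') hb₂
      (contDiff_lineAct had hb₁d σ') hb₂d
      (fun Y hY hYc => isGaugeLocal_lineAct (haloc Y hY hYc) (hb₁loc Y hY hYc) σ') hb₂loc (Rb := R)
      (fun τ' hτ' => (hHστ σ' hσ' τ' hτ').trans (P.hr.trans (by norm_num))) X ψ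
    exact h
  have hholσ : ∀ τ' ∈ ball (0 : ℂ) R, ∀ X ψ, DifferentiableOn ℂ (fun σ' => F σ' τ' X ψ) (ball (0 : ℂ) R) := by
    intro τ' hτ' X ψ
    have h := differentiableOn_nextKStep_abkm_lineAct P.hd P.hLodd P.hL Q.hM hk P.hp P.hpM P.hMR hr2 Q.hB P.hδ₀
      P.hδ₁ P.hh P.hh0 P.hA1 (Q.kernels q) hS (H₀ + τ' • U₂) U₁ (a := a + τ' • b₂) (b := b₁)
      (Ca := Ca + ‖τ'‖ * Cb₂) (Cb := Cb₁) (by positivity) hCb₁ (weakNormLE_lineAct ha hb₂ had hb₂d τ') hb₁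
      (contDiff_lineAct had hb₂d τ') hb₁d
      (fun Y hY hYc => isGaugeLocal_lineAct (haloc Y hY hYc) (hb₂loc Y hY hYc) τ') hb₁loc (Rb := R)
      (fun σ' hσ' => by
        have e : H₀ + τ' • U₂ + σ' • U₁ = H₀ + σ' • U₁ + τ' • U₂ := add_right_comm _ _ _
        rw [e]; exact (hHστ σ' hσ' τ' hτ').trans (P.hr.trans (by norm_num))) X ψ
    have e1 : ∀ σ' : ℂ, H₀ + τ' • U₂ + σ' • U₁ = H₀ + σ' • U₁ + τ' • U₂ := fun σ' => add_right_comm _ _ _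
    have e2 : ∀ σ' : ℂ, a + τ' • b₂ + σ' • b₁ = a + σ' • b₁ + τ' • b₂ := fun σ' => add_right_comm _ _ _
    simp only [e1, e2] at h
    exact h
  exact weakNormLE_secondDiff_of_pointwise_holomorphic Q.normParams (k + 1) hw (K := F) hholσ hholτ hKc hC hσ hτ

set_option maxHeartbeats 800000 in
/-- **First differences of the two-kernel difference `S_k^{(q')} − S_k^{(q)}` along a complex state line**, from a
UNIFORM bound `C_q` of that difference on the disc (for a package this bound is the two-kernel comparison (12.53) on
the Theorem-6.8 ball): `‖(S^{(q')} − S^{(q)})(σ) − (S^{(q')} − S^{(q)})(0)‖_{k+1} ≤ (r₀+1)·(2C_q/R)·|σ|`. -/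
theorem weakNormLE_sub_nextKStep_pair_package {q q' : Matrix (Fin d) (Fin d) ℝ} (hq : P.InBall q) (hq' : P.InBall q')
    {k : ℕ} (hk : k + 1 ≤ N) (H₀ U : RelevantHamiltonian ℂ d)
    {a b : Finset (Fin d → ZMod M) → ((Fin d → ZMod M) → ℝ) → ℂ} {Ca Cb : ℝ} (hCa : 0 ≤ Ca) (hCb : 0 ≤ Cb)
    (ha : WeakNormLE Q.normParams k a Ca) (hb : WeakNormLE Q.normParams k b Cb)
    (had : ∀ Y, ContDiff ℝ P.r₀ (a Y)) (hbd : ∀ Y, ContDiff ℝ P.r₀ (b Y))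
    (haloc : ∀ Y, IsPolymer (P.L ^ k) Y → IsConn Y → IsGaugeLocal (Q.normParams.gauge k Y) (a Y))
    (hbloc : ∀ Y, IsPolymer (P.L ^ k) Y → IsConn Y → IsGaugeLocal (Q.normParams.gauge k Y) (b Y))
    {R : ℝ}
    (hHball : hamNorm (fieldWt P.h (P.L : ℝ) d k) ((P.L : ℝ) ^ k) (P.L ^ (d * k)) H₀ +
      R * hamNorm (fieldWt P.h (P.L : ℝ) d k) ((P.L : ℝ) ^ k) (P.L ^ (d * k)) U ≤ P.r)
    (hKball : Ca + R * Cb ≤ P.r) {Cq : ℝ}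
    (hG : ∀ σ ∈ ball (0 : ℂ) R, WeakNormLE Q.normParams (k + 1)
      (fun X ψ => nextKStep (abkmStepData P.L P.R k (Q.kernels q')) (H₀ + σ • U) (mulExt (a + σ • b)) X ψ -
        nextKStep (abkmStepData P.L P.R k (Q.kernels q)) (H₀ + σ • U) (mulExt (a + σ • b)) X ψ) Cq)
    {σ : ℂ} (hσ : σ ∈ ball (0 : ℂ) R) :
    WeakNormLE Q.normParams (k + 1)
      (fun X ψ =>
        (nextKStep (abkmStepData P.L P.R k (Q.kernels q')) (H₀ + σ • U) (mulExt (a + σ • b)) X ψ -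
          nextKStep (abkmStepData P.L P.R k (Q.kernels q)) (H₀ + σ • U) (mulExt (a + σ • b)) X ψ) -
        (nextKStep (abkmStepData P.L P.R k (Q.kernels q')) (H₀ + (0 : ℂ) • U) (mulExt (a + (0 : ℂ) • b)) X ψ -
          nextKStep (abkmStepData P.L P.R k (Q.kernels q)) (H₀ + (0 : ℂ) • U) (mulExt (a + (0 : ℂ) • b)) X ψ))
      (((P.r₀ : ℝ) + 1) * (2 * Cq / R) * ‖σ‖) := by
  set D := abkmStepData P.L P.R k (Q.kernels q) with hD
  set D' := abkmStepData P.L P.R k (Q.kernels q') with hD'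
  set G : ℂ → Finset (Fin d → ZMod M) → ((Fin d → ZMod M) → ℝ) → ℂ :=
    fun σ X ψ => nextKStep D' (H₀ + σ • U) (mulExt (a + σ • b)) X ψ - nextKStep D (H₀ + σ • U) (mulExt (a + σ • b)) X ψ
    with hGdef
  have hS := packageAt_stepKernelBounds P Q hq hk
  have hS' := packageAt_stepKernelBounds P Q hq' hk
  have hPA : 0 < Q.normParams.A := P.A_pos
  have hL0 : (0 : ℝ) < P.L := by exact_mod_cast P.hLodd.pos
  have h𝔥 : 0 ≤ fieldWt P.h (P.L : ℝ) d k := (fieldWt_pos P.hh hL0 d k).le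
  have hRk : (0 : ℝ) ≤ (P.L : ℝ) ^ k := by positivity
  have hk1 : 1 ≤ P.L ^ k := Nat.one_le_pow _ _ P.hLodd.pos
  have hr2 : (2 : ℕ) ≤ P.r₀ := le_trans (by norm_num) P.hr₀
  have hn0 : ∀ G : RelevantHamiltonian ℂ d, 0 ≤ hamNorm (fieldWt P.h (P.L : ℝ) d k) ((P.L : ℝ) ^ k) (P.L ^ (d * k)) G :=
    fun G => hamNorm_nonneg h𝔥 hRk _ _
  have hHσ : ∀ σ' ∈ ball (0 : ℂ) R,
      hamNorm (fieldWt P.h (P.L : ℝ) d k) ((P.L : ℝ) ^ k) (P.L ^ (d * k)) (H₀ + σ' • U) ≤ 1 / 8 := by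
    intro σ' hσ'
    have h1 := hamNorm_add_le h𝔥 hRk (P.L ^ (d * k)) H₀ (σ' • U)
    rw [hamNorm_complex_smul] at h1
    have hσ'' : ‖σ'‖ ≤ R := le_of_lt (mem_ball_zero_iff.1 hσ')
    have : hamNorm (fieldWt P.h (P.L : ℝ) d k) ((P.L : ℝ) ^ k) (P.L ^ (d * k)) (H₀ + σ' • U) ≤ P.r := by
      nlinarith [hn0 U]
    exact this.trans (P.hr.trans (by norm_num))
  have hKσ : ∀ σ' ∈ ball (0 : ℂ) R, WeakNormLE Q.normParams k (mulExt (a + σ' • b)) P.r := by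
    intro σ' hσ'
    have hσ'' : ‖σ'‖ ≤ R := le_of_lt (mem_ball_zero_iff.1 hσ')
    refine weakNormLE_mulExt_iff.2 ((weakNormLE_lineAct ha hb had hbd σ').mono hPA ?_)
    nlinarith
  have hKd : ∀ σ' Y, ContDiff ℝ P.r₀ (mulExt (a + σ' • b) Y) := fun σ' Y =>
    contDiff_mulExt (contDiff_lineAct had hbd σ') Y
  have hKloc : ∀ σ' Y, IsPolymer (P.L ^ k) Y → IsConn Y →
      IsGaugeLocal (Q.normParams.gauge k Y) (mulExt (a + σ' • b) Y) := fun σ' Y hY hYc =>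
    isGaugeLocal_mulExt_conn (Q.normParams.gauge k)
      (fun Y' hY' hY'c => isGaugeLocal_lineAct (haloc Y' hY' hY'c) (hbloc Y' hY' hY'c) σ') hY hYc
  -- engine inputs
  have hw : ∀ X, Continuous (Q.normParams.W.weight (k + 1) X) := fun X => continuous_weight _ (k + 1) X
  have hhol : ∀ X ψ, DifferentiableOn ℂ (fun σ' => G σ' X ψ) (ball (0 : ℂ) R) := by
    intro X ψ
    have h1 := differentiableOn_nextKStep_abkm_lineAct P.hd P.hLodd P.hL Q.hM hk P.hp P.hpM P.hMR hr2 Q.hB P.hδ₀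
      P.hδ₁ P.hh P.hh0 P.hA1 (Q.kernels q') hS' H₀ U hCa hCb ha hb had hbd haloc hbloc (Rb := R) hHσ X ψ
    have h2 := differentiableOn_nextKStep_abkm_lineAct P.hd P.hLodd P.hL Q.hM hk P.hp P.hpM P.hMR hr2 Q.hB P.hδ₀
      P.hδ₁ P.hh P.hh0 P.hA1 (Q.kernels q) hS H₀ U hCa hCb ha hb had hbd haloc hbloc (Rb := R) hHσ X ψ
    exact h1.sub h2
  have hKc : ∀ σ' ∈ ball (0 : ℂ) R, ∀ X, ContDiff ℝ (Q.normParams.r₀ : WithTop ℕ∞) (G σ' X) := by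
    intro σ' hσ' X
    have h1 := contDiff_nextKStep_abkm_of_stepKernelBounds P.hd P.hLodd P.hL Q.hM hk P.hp P.hpM P.hMR Q.hB P.hδ₀
      P.hδ₁ P.hh P.hh0 P.hA1 D' rfl rfl hS' (x₀ := 0) rfl rfl (hHσ σ' hσ') P.hr0 (hKσ σ' hσ') (factorises_mulExt hk1)
      (fun φ => mulExt_empty φ) (hKd σ') (hKloc σ') X
    have h2 := contDiff_nextKStep_abkm_of_stepKernelBounds P.hd P.hLodd P.hL Q.hM hk P.hp P.hpM P.hMR Q.hB P.hδ₀
      P.hδ₁ P.hh P.hh0 P.hA1 D rfl rfl hS (x₀ := 0) rfl rfl (hHσ σ' hσ') P.hr0 (hKσ σ' hσ') (factorises_mulExt hk1)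
      (fun φ => mulExt_empty φ) (hKd σ') (hKloc σ') X
    exact h1.sub h2
  exact weakNormLE_sub_of_pointwise_holomorphic Q.normParams (k + 1) hw (K := G) hhol hKc hG hσ

end Engines

end Summit.HubbardSuperconductivity.HubbardSuperconductivity.Theorems.ComplexGFF

end
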